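import Summits.Ventures.PercRepro.RankLevelSetBiIndepMixedNormSkewSharp

/-! # RankLevelSetBiIndepMixedCompl — COMPLEMENTATION SWAPS THE CONTAIN- AND AVOID-SETS; THE LEFT-SKEW COLUMN OF THE
TWO-SIDED TABLE (night-1 g31; dossier §43.8–§43.9)

`Z ↦ E ∖ Z` is a bijection from the mixed family `(Y₁, Y₂)` at level `k` onto the mixed family `(Y₂, Y₁)` at level
`#E − k` (**`mixedCount_compl`**). Hence the sharp right-skew statement of `RankLevelSetBiIndepMixedNormSkewSharp`
for the swapped pair is the LEFT-skew statement for the original one: under (CUM-norm) on the minors, for every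
`Y₁, Y₂ ⊆ E` and `k < k'` with `k + k' ≥ #E + #Y₁ + 1` (and `k' ≤ #E`),
`q^{Y₁,Y₂}_{k'} · C(#E − #Y₁, #E − k) ≤ q^{Y₁,Y₂}_k · C(#E − #Y₁, #E − k')` (**`mixedCount_left_normSkew`**) — the
column (L) of dossier §43.8 (normalization `C(f + #Y₂, ·)` in the `S`-index), and at the exact pair
`k + k' = #E + #Y₁` the unnormalized `q_{k'} ≤ q_k` (**`mixedCount_left_reflect`**; at `Y₂ = ∅` this is the twin of
(★★)_{Y₁}). Every declaration has a docstring; imports: the cell's own modules and Mathlib only. Axioms: standard. -/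

namespace PercRepro

open Set Matroid

variable {α : Type} (M : Matroid α) [M.Finite]

/-- **Complementation swaps the contain- and avoid-sets**: `#mixedSets M Y₁ Y₂ k = #mixedSets M Y₂ Y₁ (#E − k)` for
`Y₁, Y₂ ⊆ E` and `k ≤ #E`. -/
lemma mixedCount_compl {Y₁ Y₂ : Set α} (hY₁ : Y₁ ⊆ M.E) (hY₂ : Y₂ ⊆ M.E) {k : ℕ} (hk : k ≤ M.E.ncard) :
    mixedCount M Y₁ Y₂ k = mixedCount M Y₂ Y₁ (M.E.ncard - k) := by
  unfold mixedCount mixedSets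
  refine Set.ncard_congr (fun Z _ => M.E \ Z) ?_ ?_ ?_
  · rintro Z ⟨hZ, hY₁Z, hd⟩
    refine ⟨mem_biIndep_compl M hZ, ?_, ?_⟩
    · intro z hz
      exact ⟨hY₂ hz, fun hzZ => (Set.disjoint_left.mp hd) hzZ hz⟩
    · rw [Set.disjoint_left]
      rintro z ⟨-, hzZ⟩ hzY
      exact hzZ (hY₁Z hzY)
  · rintro Z Z' ⟨hZ, -, -⟩ ⟨hZ', -, -⟩ h
    have h1 : Z = M.E \ (M.E \ Z) := (Set.sdiff_sdiff_cancel_left hZ.1).symm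
    have h2 : Z' = M.E \ (M.E \ Z') := (Set.sdiff_sdiff_cancel_left hZ'.1).symm
    rw [h1, h2, h]
  · rintro W ⟨hW, hY₂W, hd⟩
    refine ⟨M.E \ W, ⟨?_, ?_, ?_⟩, Set.sdiff_sdiff_cancel_left hW.1⟩
    · have := mem_biIndep_compl M hW
      rwa [show M.E.ncard - (M.E.ncard - k) = k by omega] at this
    · intro z hz
      exact ⟨hY₁ hz, fun hzW => (Set.disjoint_left.mp hd) hzW hz⟩
    · rw [Set.disjoint_left]
      rintro z ⟨-, hzW⟩ hzY
      exact hzW (hY₂W hzY)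

/-- **The left-skew column (L)**: under (CUM-norm) on the minors, for `Y₁, Y₂ ⊆ E` and `k < k' ≤ #E` with
`k + k' ≥ #E + #Y₁ + 1`: `q_{k'} · C(#E − #Y₁, #E − k) ≤ q_k · C(#E − #Y₁, #E − k')`. -/
theorem mixedCount_left_normSkew (h : ∀ N : Matroid α, Matroid.IsMinor N M → BiContainNormSkew N)
    {Y₁ Y₂ : Set α} (hY₁ : Y₁ ⊆ M.E) (hY₂ : Y₂ ⊆ M.E) {k k' : ℕ} (hkk : k < k') (hk' : k' ≤ M.E.ncard)
    (hsum : M.E.ncard + Y₁.ncard + 1 ≤ k + k') :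
    mixedCount M Y₁ Y₂ k' * (M.E.ncard - Y₁.ncard).choose (M.E.ncard - k) ≤
      mixedCount M Y₁ Y₂ k * (M.E.ncard - Y₁.ncard).choose (M.E.ncard - k') := by
  have hR : mixedCount M Y₂ Y₁ (M.E.ncard - k') * (M.E.ncard - Y₁.ncard).choose (M.E.ncard - k) ≤
      mixedCount M Y₂ Y₁ (M.E.ncard - k) * (M.E.ncard - Y₁.ncard).choose (M.E.ncard - k') :=
    mixedCount_normSkewBelow M h hY₂ hY₁ (M.E.ncard - k') (M.E.ncard - k) (by omega) (by omega)
  rw [mixedCount_compl M hY₁ hY₂ hk', mixedCount_compl M hY₁ hY₂ (by omega : k ≤ M.E.ncard)]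
  exact hR

/-- **The exact left reflection of the contain profile**: `α^{Y₁}_{k'} ≤ α^{Y₁}_k` for `k < k'`,
`k + k' = #E + #Y₁` — (★★)_{Y₁} in contain form (the `Y₂ = ∅` case; for `Y₂ ≠ ∅` only the pairs beyond the exact
one are claimed, as in dossier §43.8). -/
theorem mixedCount_left_reflect (h : ∀ N : Matroid α, Matroid.IsMinor N M → BiContainNormSkew N)
    {Y₁ : Set α} (hY₁ : Y₁ ⊆ M.E) {k k' : ℕ} (hkk : k < k') (hk' : k' ≤ M.E.ncard)
    (hsum : k + k' = M.E.ncard + Y₁.ncard) :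
    mixedCount M Y₁ ∅ k' ≤ mixedCount M Y₁ ∅ k := by
  have hS : mixedCount M ∅ Y₁ (M.E.ncard - k') * (M.E.ncard - Y₁.ncard).choose (M.E.ncard - k) ≤
      mixedCount M ∅ Y₁ (M.E.ncard - k) * (M.E.ncard - Y₁.ncard).choose (M.E.ncard - k') :=
    mixedCount_avoid_normSkew M h hY₁ (M.E.ncard - k') (M.E.ncard - k) (by omega) (by omega)
  rw [mixedCount_compl M hY₁ (Set.empty_subset _) hk', mixedCount_compl M hY₁ (Set.empty_subset _)
    (by omega : k ≤ M.E.ncard)]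
  have hsym : (M.E.ncard - Y₁.ncard).choose (M.E.ncard - k) = (M.E.ncard - Y₁.ncard).choose (M.E.ncard - k') := by
    have := Nat.choose_symm (n := M.E.ncard - Y₁.ncard) (k := M.E.ncard - k') (by omega)
    rwa [show M.E.ncard - Y₁.ncard - (M.E.ncard - k') = M.E.ncard - k by omega] at this
  rw [hsym] at hS
  exact Nat.le_of_mul_le_mul_right hS (Nat.choose_pos (by omega))

/-- **(★★)_X in contain form, as a statement about the contain profile**: `α^X_{k'} ≤ α^X_k` for `k < k'`,
`k + k' = #E + #X`. -/
theorem biContainCount_reflect_of_forall_minor_normSkew (h : ∀ N : Matroid α, Matroid.IsMinor N M → BiContainNormSkew N)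
    {X : Set α} (hX : X ⊆ M.E) {k k' : ℕ} (hkk : k < k') (hk' : k' ≤ M.E.ncard)
    (hsum : k + k' = M.E.ncard + X.ncard) : biContainCount M X k' ≤ biContainCount M X k := by
  rw [← mixedCount_empty_right, ← mixedCount_empty_right]
  exact mixedCount_left_reflect M h hX hkk hk' hsum

end PercRepro
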